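import Literature.InformationTheory.QuantumCodes.CSSThresholdConverses
import HarnessLib

/-!
# Rate versus erasure and code-capacity thresholds of CSS codes: `R ≤ 1 − y_Z − y_X`

Bennett–DiVincenzo–Smolin, *Capacities of quantum erasure channels*, PRL 78 (1997) 3217
[BennettDivincenzoSmolin1997]: the quantum capacity of the erasure channel of rate `ε` is `Q = max{0, 1 − 2ε}`
(«two bits of redundancy per erased qubit are necessary and sufficient … to recover the phase and amplitude of
all erased qubits with probability tending to 1»). Delfosse–Zémor, *Upper bounds on the rate of low density
stabilizer codes for the quantum erasure channel*, QIC 13 (2013) 793 [DelfosseZemor2013] §3: for STABILIZER codes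
the achievable rates over the erasure channel satisfy `R ≤ 1 − 2p` (eq. (capacity) of §3, Thm. 3.5 with `D = 0`),
by a combinatorial count. Bravyi–Poulin–Terhal [BravyiPoulinTerhal2010] Eqs. (5)–(8): for a partition
`Λ = ABC` with `A` and `B` correctable, `k ≤ |C|`.

This file PROVES the sector-wise CSS versions, in the tree's vocabulary of `CSSThresholdConverses.lean`
(`IsCorrectableErasure`, `uncorrectableProb`, `bernoulliWeight`, `BelowThreshold`, `IsThresholdLowerBound`,
`accuracyThreshold`), for EVERY CSS code and EVERY family — «one bit of redundancy per erased qubit per sector»: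

* HOLOGRAPHIC BOUND, sector-wise (`CSSCode.k_le_card_compl_sdiff`, `CSSCode.k_add_card_union_le`): if the set of
  qubits `E` is correctable for the `Z`-sector (no `Z`-logical inside `E`) and `F` for the `X`-sector, then
  `k ≤ |Λ ∖ (E ∪ F)|` — by the CSS Cleaning Lemma (`css_cleaning`: all `X`-logicals live on `Eᶜ` modulo
  stabilizers, `CSSCode.kerZ_eq_rowSpX_sup`) and restriction to the coordinates `Eᶜ ∖ F` (an `X`-logical on `Eᶜ`
  vanishing there lives inside `F`, hence is a stabilizer).
* FINITE-SIZE RATE BOUND (`CSSCode.k_le_card_mul_erasure`): for every CSS code on `n` qubits and erasure rates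
  `y_Z, y_X ≥ 0` with `y_Z + y_X ≤ 1`,
  `k ≤ n · (1 − y_Z − y_X + P^Z_{y_Z}[erasure uncorrectable] + P^X_{y_X}[erasure uncorrectable])`.
  Proof: couple the two erasure patterns disjointly (each qubit is `Z`-erased w.p. `y_Z`, `X`-erased w.p. `y_X`,
  neither w.p. `1 − y_Z − y_X`; marginals `sum_pairWeight_mul_left/right`), average the pointwise bound
  `|E| + |F| ≤ (n − k) + n·𝟙[E fails] + n·𝟙[F fails]` and use `𝔼|E| = n y_Z` (`sum_bernoulliWeight_mul_card`).
  Only the two MARGINAL laws enter, so the bound covers the genuine quantum erasure channel (same erased set for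
  both sectors, `y_Z = y_X = ε`: `R ≤ 1 − 2ε + 2 P_ε[fail]`, the printed converse) as well as independent sectors.
* CODE-CAPACITY VERSION (`CSSCode.k_le_card_mul_capacity`): for ANY pair of syndrome decoders and flip rates
  `p, p' ≥ 0`, `p + p' ≤ 1/2`: `k ≤ n · (1 − 2p − 2p' + 2 P^Z_p[D_Z fails] + 2 P^X_{p'}[D_X fails])`
  (erasure decomposition `P_{2p}[uncorrectable] ≤ 2 P_p[D fails]`, `CSSCode.zUncorrectableProb_two_mul_le`).
* FAMILIES with `k ≥ 1` and rate `≥ R` (`R · n_i ≤ k_i` for all `i`): certified erasure threshold lower bounds of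
  the two sectors satisfy `a + b ≤ 1 − R` (`erasure_thresholds_add_le_one_sub_rate`; each alone `≤ 1 − R`;
  symmetric families `≤ (1 − R)/2` — the BDS97 value), accuracy-threshold forms `y_c^Z + y_c^X ≤ 1 − R`; code-capacity
  threshold lower bounds under ANY decoders satisfy `a + b ≤ (1 − R)/2` (`capacity_thresholds_add_le_half_sub`;
  each alone `≤ (1 − R)/2`; symmetric `≤ (1 − R)/4`), accuracy-threshold forms `p_c^Z + p_c^X ≤ (1 − R)/2`.
  The rate-free versions (`R = 0`: `a + b ≤ 1`, `a + b ≤ 1/2`) are `CSSThresholdConverses.lean`.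

## References

* [BennettDivincenzoSmolin1997] PRL 78 (1997) 3217 = arXiv:quant-ph/9701015, p. 3218 (chunk p0003 L59–L80:
  `Q = max{0, 1−2ε}`, «upper bound Q ≤ 1−2ε», «two bits of redundancy per erased qubit are necessary»).
* [DelfosseZemor2013] QIC 13 (2013) 793 = arXiv:1205.7036, §3 eq. (capacity) `Q ≤ 1 − 2p` (chunk p0007 L4–L15),
  §3.3 (chunk p0008 L85–L95: `2|ℰ| ≤ rank H`, «R ≤ 1−2p which recovers (capacity) for stabilizer codes»), Thm. 3.5.
* [BravyiPoulinTerhal2010] PRL 104 (2010) 050503 = arXiv:0909.5200, Eqs. (5)–(8) (`k ≤ |C|`, chunk p0004 L244–255).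
* [BravyiTerhal2009] NJP 11 (2009) 043029, §2 Lemma 1 (Cleaning Lemma) — `css_cleaning`.
* [RichardsonUrbanke2008] Modern Coding Theory, Lemma 4.78 (Erasure Decomposition Lemma).
* [DennisEtAl2002] §4.3, §4.6 (below threshold, `p_c`).

## Mathlib / tree search

Tree: `css_cleaning`, `suppIn`, `mem_suppIn_iff(_supp)`, `CSSCode.k_le`-type facts (`CSSCode.k`, `k_eq`,
`rowSpX_le_kerZ`), `bernoulliWeight`, `sum_bernoulliWeight`, `sum_bernoulliWeight_filter_superset`,
`ErasureDecoder.uncorrectableProb(_eq_sum)`, `uncorrectableProb_zero`, `CSSCode.z/xUncorrectableProb_two_mul_le`,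
`erasure_thresholds_add_le_one`, `capacity_thresholds_add_le_half`, `capacity_threshold_le_half`,
`isThresholdLowerBound_accuracyThreshold`, `isThresholdLowerBound_of_nonpos` (CSSThresholdConverses / CodeCapacityNoise).
Mathlib: `Finset.sum_pow_mul_eq_add_pow`, `Finset.sum_comm'`, `Submodule.finrank_sup_add_finrank_inf_eq`,
`LinearMap.finrank_range_add_finrank_ker`, `Submodule.finrank_map_subtype_eq`, `LinearMap.funLeft`,
`le_of_tendsto_of_tendsto'`.
-/

namespace Literature.InformationTheory.QuantumCodes

open Finset Matrix Module Coding Filter Topology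

/-! ### The sector-wise holographic bound `k ≤ |Λ ∖ (E ∪ F)|` -/

section Holographic

variable {RX RZ V : Type*} [Fintype V] [DecidableEq V]

omit [DecidableEq V] in
/-- `k ≤ n` for a CSS code (`k = n − rank H^X − rank H^Z`). [cite: BravyiEtAl2024, §4, proof of Lemma 1 ("k = n − rk(H^X) − rk(H^Z)")] -/
theorem CSSCode.k_le_card [Fintype RX] (C : CSSCode RX RZ V) : C.k ≤ Fintype.card V := by
  rw [CSSCode.k_eq]
  omega

/-- **Cleaning as a decomposition**: if `E` is correctable for the `Z`-sector (no `Z`-logical inside `E`), every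
`X`-logical can be cleaned onto `Eᶜ`, i.e. `ker H^Z = rs H^X + (ker H^Z ∩ 𝔽₂^{Eᶜ})`.
[cite: BravyiTerhal2009, §2 Lemma 1 (Cleaning Lemma, case (2))] -/
theorem CSSCode.kerZ_eq_rowSpX_sup [Fintype RX] [Fintype RZ] (C : CSSCode RX RZ V) {E : Finset V}
    (hE : IsCorrectableErasure {x | C.HX *ᵥ x = 0} (C.rowSpZ : Set (V → ZMod 2)) E) :
    C.kerZ = C.rowSpX ⊔ (C.kerZ ⊓ suppIn Eᶜ) := by
  refine le_antisymm (fun x hx => ?_) (sup_le C.rowSpX_le_kerZ inf_le_left)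
  have hE' : IsCorrectableErasure {x | C.HX *ᵥ x = 0} (rowSpace C.HZ : Set (V → ZMod 2)) Eᶜᶜ := by
    rw [compl_compl]
    exact hE
  obtain ⟨s, hs, hsupp⟩ := css_cleaning C.HZ C.HX hE' ((C.mem_kerZ_iff x).1 hx)
  have hxs : x + s ∈ C.kerZ ⊓ suppIn Eᶜ :=
    ⟨C.kerZ.add_mem hx (C.rowSpX_le_kerZ hs), mem_suppIn_iff_supp.2 hsupp⟩
  exact Submodule.mem_sup.2 ⟨-s, C.rowSpX.neg_mem hs, x + s, hxs, by abel⟩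

/-- **Sector-wise holographic bound.** If `E` is correctable for the `Z`-sector of a CSS code (every
`z ∈ ker H^X` supported in `E` is a `Z`-stabilizer) and `F` is correctable for the `X`-sector, then
`k ≤ |Eᶜ ∖ F| = |Λ ∖ (E ∪ F)|`: all `k` independent `X`-logicals live on `Eᶜ` (cleaning), and the restriction of
`ker H^Z ∩ 𝔽₂^{Eᶜ}` to the coordinates `Eᶜ ∖ F` kills only vectors supported in `F`, which are stabilizers.
The CSS refinement of «`Λ = ABC`, `A`, `B` correctable ⇒ `k ≤ |C|`».
[cite: BravyiPoulinTerhal2010, Eqs. (5)–(8) (k ≤ |C|); DelfosseZemor2013, §3.3 (2|ℰ| ≤ rank H)] -/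
theorem CSSCode.k_le_card_compl_sdiff [Fintype RX] [Fintype RZ] (C : CSSCode RX RZ V) {E F : Finset V}
    (hE : IsCorrectableErasure {x | C.HX *ᵥ x = 0} (C.rowSpZ : Set (V → ZMod 2)) E)
    (hF : IsCorrectableErasure {x | C.HZ *ᵥ x = 0} (C.rowSpX : Set (V → ZMod 2)) F) :
    C.k ≤ (Eᶜ \ F).card := by
  have hdec := C.kerZ_eq_rowSpX_sup hE
  have hsup := Submodule.finrank_sup_add_finrank_inf_eq C.rowSpX (C.kerZ ⊓ suppIn Eᶜ)
  rw [← hdec] at hsup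
  -- restriction of `ker H^Z ∩ 𝔽₂^{Eᶜ}` to the coordinates in `Eᶜ ∖ F`
  let φ : ↥(C.kerZ ⊓ suppIn Eᶜ) →ₗ[ZMod 2] (↥(Eᶜ \ F) → ZMod 2) :=
    (LinearMap.funLeft (ZMod 2) (ZMod 2) (Subtype.val : ↥(Eᶜ \ F) → V)) ∘ₗ (C.kerZ ⊓ suppIn Eᶜ).subtype
  -- its kernel consists of `X`-logicals supported inside `F`: stabilizers
  have h1 : (LinearMap.ker φ).map (C.kerZ ⊓ suppIn Eᶜ).subtype ≤ C.rowSpX ⊓ (C.kerZ ⊓ suppIn Eᶜ) := by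
    rintro _ ⟨x, hx, rfl⟩
    refine ⟨?_, x.2⟩
    have hxK := x.2
    refine hF (x : V → ZMod 2) hxK.1 fun v hv => ?_
    have hv' : (x : V → ZMod 2) v ≠ 0 := by simpa [supp] using hv
    by_contra hvF
    have hvE : v ∈ Eᶜ := by
      by_contra hvE
      exact hv' (mem_suppIn_iff.1 hxK.2 v hvE)
    have h0 := congrFun (LinearMap.mem_ker.1 hx) ⟨v, Finset.mem_sdiff.2 ⟨hvE, hvF⟩⟩
    simp only [φ, LinearMap.coe_comp, Function.comp_apply, Submodule.coe_subtype, LinearMap.funLeft_apply,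
      Pi.zero_apply] at h0
    exact hv' h0
  have h2 : finrank (ZMod 2) (LinearMap.ker φ) ≤ finrank (ZMod 2) ↥(C.rowSpX ⊓ (C.kerZ ⊓ suppIn Eᶜ)) := by
    rw [← Submodule.finrank_map_subtype_eq (C.kerZ ⊓ suppIn Eᶜ) (LinearMap.ker φ)]
    exact Submodule.finrank_mono h1
  have h3 : finrank (ZMod 2) (LinearMap.range φ) ≤ (Eᶜ \ F).card :=
    calc finrank (ZMod 2) (LinearMap.range φ) ≤ finrank (ZMod 2) (↥(Eᶜ \ F) → ZMod 2) :=
          Submodule.finrank_le _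
      _ = (Eᶜ \ F).card := by rw [Module.finrank_fintype_fun_eq_card, Fintype.card_coe]
  have h4 := LinearMap.finrank_range_add_finrank_ker φ
  have h5 := Submodule.finrank_mono C.rowSpX_le_kerZ
  unfold CSSCode.k
  omega

/-- Additive form: `k + |E ∪ F| ≤ n` whenever `E` is `Z`-correctable and `F` is `X`-correctable.
[cite: BravyiPoulinTerhal2010, Eqs. (5)–(8) (k ≤ |C| for Λ = ABC)] -/
theorem CSSCode.k_add_card_union_le [Fintype RX] [Fintype RZ] (C : CSSCode RX RZ V) {E F : Finset V}
    (hE : IsCorrectableErasure {x | C.HX *ᵥ x = 0} (C.rowSpZ : Set (V → ZMod 2)) E)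
    (hF : IsCorrectableErasure {x | C.HZ *ᵥ x = 0} (C.rowSpX : Set (V → ZMod 2)) F) :
    C.k + (E ∪ F).card ≤ Fintype.card V := by
  have h := C.k_le_card_compl_sdiff hE hF
  have h1 : Eᶜ \ F = (E ∪ F)ᶜ := by
    ext v
    simp only [Finset.mem_sdiff, Finset.mem_compl, Finset.mem_union, not_or]
  rw [h1, Finset.card_compl] at h
  have h2 := (E ∪ F).card_le_univ
  omega

end Holographic

/-! ### The disjoint coupling of two erasure patterns -/

section Coupling

variable {V : Type*} [Fintype V] [DecidableEq V]

/-- **First marginal of the disjoint coupling.** Weighting the disjoint pairs `(E, F)`, `F ⊆ Eᶜ`, by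
`a^{|E|} b^{|F|} (1−a−b)^{n−|E|−|F|}` (each qubit in `E` w.p. `a`, in `F` w.p. `b`, in neither otherwise), the law
of `E` is the independent erasure law of rate `a` (binomial theorem on `Eᶜ`).
[cite: DelfosseZemor2013, §3.1 (each qubit is erased independently with probability p)] -/
theorem sum_pairWeight_mul_left (a b : ℝ) (f : Finset V → ℝ) :
    ∑ E : Finset V, ∑ F ∈ (Eᶜ).powerset,
        a ^ E.card * (b ^ F.card * (1 - a - b) ^ (Eᶜ.card - F.card)) * f E =
      ∑ E : Finset V, bernoulliWeight a E * f E := by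
  refine Finset.sum_congr rfl fun E _ => ?_
  rw [← Finset.sum_mul, ← Finset.mul_sum, Finset.sum_pow_mul_eq_add_pow, Finset.card_compl,
    show b + (1 - a - b) = 1 - a by ring, bernoulliWeight]

/-- **Second marginal of the disjoint coupling**: the law of `F` is the independent erasure law of rate `b`
(exchange the sums — `F ⊆ Eᶜ ↔ E ⊆ Fᶜ` — and use the binomial theorem on `Fᶜ`).
[cite: DelfosseZemor2013, §3.1 (each qubit is erased independently with probability p)] -/
theorem sum_pairWeight_mul_right (a b : ℝ) (g : Finset V → ℝ) :
    ∑ E : Finset V, ∑ F ∈ (Eᶜ).powerset,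
        a ^ E.card * (b ^ F.card * (1 - a - b) ^ (Eᶜ.card - F.card)) * g F =
      ∑ F : Finset V, bernoulliWeight b F * g F := by
  rw [Finset.sum_comm' (t' := (univ : Finset (Finset V))) (s' := fun F => (Fᶜ).powerset)
    (fun E F => by
      simp only [Finset.mem_univ, true_and, and_true, Finset.mem_powerset]
      constructor
      · intro h v hv
        rw [Finset.mem_compl]
        intro hvF
        exact (Finset.mem_compl.1 (h hvF)) hv
      · intro h v hv
        rw [Finset.mem_compl]
        intro hvE
        exact (Finset.mem_compl.1 (h hvE)) hv)]
  refine Finset.sum_congr rfl fun F _ => ?_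
  have hexp : ∀ E ∈ (Fᶜ).powerset,
      a ^ E.card * (b ^ F.card * (1 - a - b) ^ (Eᶜ.card - F.card)) * g F =
        b ^ F.card * (a ^ E.card * (1 - a - b) ^ (Fᶜ.card - E.card)) * g F := by
    intro E _
    rw [Finset.card_compl, Finset.card_compl, Nat.sub_right_comm]
    ring
  rw [Finset.sum_congr rfl hexp, ← Finset.sum_mul, ← Finset.mul_sum, Finset.sum_pow_mul_eq_add_pow,
    Finset.card_compl, show a + (1 - a - b) = 1 - b by ring, bernoulliWeight]

/-- **Mean number of erased qubits**: `Σ_E a^{|E|}(1−a)^{n−|E|} |E| = n a` (each qubit is erased with probability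
`a`: `P[v ∈ E] = a` by `sum_bernoulliWeight_filter_superset`).
[cite: DelfosseZemor2013, §3.3 (the typical weight of an erasure being |ℰ| = np)] -/
theorem sum_bernoulliWeight_mul_card (a : ℝ) :
    ∑ E : Finset V, bernoulliWeight a E * (E.card : ℝ) = Fintype.card V * a := by
  have h1 : ∀ E : Finset V, bernoulliWeight a E * (E.card : ℝ) = ∑ v ∈ E, bernoulliWeight a E := by
    intro E
    rw [Finset.sum_const, nsmul_eq_mul, mul_comm]
  rw [Finset.sum_congr rfl fun E _ => h1 E,
    Finset.sum_comm' (t' := (univ : Finset V)) (s' := fun v => univ.filter fun E : Finset V => v ∈ E)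
      (fun E v => by simp)]
  have h2 : ∀ v : V, ∑ E ∈ univ.filter (fun E : Finset V => v ∈ E), bernoulliWeight a E = a := by
    intro v
    have h := sum_bernoulliWeight_filter_superset a ({v} : Finset V)
    rw [Finset.card_singleton, pow_one] at h
    have hs : (univ.filter fun E : Finset V => v ∈ E) = univ.filter fun E : Finset V => {v} ⊆ E := by
      ext E
      simp
    rw [hs]
    exact h
  rw [Finset.sum_congr rfl fun v _ => h2 v, Finset.sum_const, Finset.card_univ, nsmul_eq_mul]

omit [DecidableEq V] in
/-- An erasure event's probability as a weighted indicator sum (any decidability instances).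
[cite: DelfosseZemor2013, §3.1 (erasure law)] -/
theorem sum_bernoulliWeight_mul_ite_eq_uncorrectableProb (N S : Set (V → ZMod 2)) (p : ℝ)
    [DecidablePred fun E : Finset V => IsCorrectableErasure N S E] :
    ∑ E : Finset V, bernoulliWeight p E * (if IsCorrectableErasure N S E then 0 else 1) =
      ErasureDecoder.uncorrectableProb N S p := by
  classical
  rw [ErasureDecoder.uncorrectableProb_eq_sum, Finset.sum_filter]
  refine Finset.sum_congr rfl fun E _ => ?_
  by_cases h : IsCorrectableErasure N S E
  · rw [if_pos h, if_neg (not_not.2 h), mul_zero]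
  · rw [if_neg h, if_pos h, mul_one]

end Coupling

/-! ### The finite-size rate bound -/

section Finite

variable {RX RZ V : Type*} [Fintype V] [DecidableEq V] [Fintype RX] [Fintype RZ]

open Classical in
/-- Pointwise bound under the coupling: for disjoint `E`, `F` and a weight `w ≥ 0`,
`w(|E| + |F|) ≤ w(n − k) + n·w·𝟙[E not Z-correctable] + n·w·𝟙[F not X-correctable]` (if both are correctable this
is the holographic bound, otherwise `|E| + |F| ≤ n`). [cite: BravyiPoulinTerhal2010, Eqs. (5)–(8)] -/
private theorem pointwise_rate_bound (C : CSSCode RX RZ V) (E F : Finset V) (hF : F ⊆ Eᶜ) {w : ℝ} (hw : 0 ≤ w) :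
    w * (E.card : ℝ) + w * (F.card : ℝ) ≤
      w * ((Fintype.card V : ℝ) - C.k) +
        (Fintype.card V : ℝ) *
          (w * (if IsCorrectableErasure {x | C.HX *ᵥ x = 0} (C.rowSpZ : Set (V → ZMod 2)) E then 0 else 1)) +
        (Fintype.card V : ℝ) *
          (w * (if IsCorrectableErasure {x | C.HZ *ᵥ x = 0} (C.rowSpX : Set (V → ZMod 2)) F then 0 else 1)) := by
  have hkn : (C.k : ℝ) ≤ Fintype.card V := by exact_mod_cast C.k_le_card
  have hEF : (E.card : ℝ) + F.card ≤ Fintype.card V := by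
    have h1 := Finset.card_le_card hF
    rw [Finset.card_compl] at h1
    have h2 := E.card_le_univ
    exact_mod_cast (by omega : E.card + F.card ≤ Fintype.card V)
  have hk1 := mul_le_mul_of_nonneg_left hEF hw
  have hk2 := mul_le_mul_of_nonneg_left hkn hw
  by_cases hZ : IsCorrectableErasure {x | C.HX *ᵥ x = 0} (C.rowSpZ : Set (V → ZMod 2)) E
  · by_cases hX : IsCorrectableErasure {x | C.HZ *ᵥ x = 0} (C.rowSpX : Set (V → ZMod 2)) F
    · rw [if_pos hZ, if_pos hX]
      have h := C.k_le_card_compl_sdiff hZ hX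
      have h1 := Finset.card_sdiff_add_card_eq_card hF
      rw [Finset.card_compl] at h1
      have h2 := E.card_le_univ
      have h3 : (C.k : ℝ) + E.card + F.card ≤ Fintype.card V := by
        exact_mod_cast (by omega : C.k + E.card + F.card ≤ Fintype.card V)
      have h4 := mul_le_mul_of_nonneg_left h3 hw
      nlinarith [h4]
    · rw [if_pos hZ, if_neg hX]
      have hn : (0 : ℝ) ≤ Fintype.card V := Nat.cast_nonneg _
      nlinarith [hk1, hk2]
  · rw [if_neg hZ]
    have hi : (0 : ℝ) ≤
        w * (if IsCorrectableErasure {x | C.HZ *ᵥ x = 0} (C.rowSpX : Set (V → ZMod 2)) F then 0 else 1) :=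
      mul_nonneg hw (by split_ifs <;> norm_num)
    have hn : (0 : ℝ) ≤ Fintype.card V := Nat.cast_nonneg _
    nlinarith [hk1, hk2, mul_nonneg hn hi]

/-- **FINITE-SIZE RATE BOUND («one bit of redundancy per erased qubit per sector»).** For every CSS code on `n`
qubits and erasure rates `y_Z, y_X ≥ 0` with `y_Z + y_X ≤ 1`:
`k ≤ n · (1 − y_Z − y_X + P^Z_{y_Z}[erasure uncorrectable] + P^X_{y_X}[erasure uncorrectable])`.
Only the marginal erasure laws enter (the proof couples the two patterns disjointly), so with `y_Z = y_X = ε` and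
the same erased set this is the code-level form of `R ≤ 1 − 2ε` («two bits of redundancy per erased qubit are
necessary»). [cite: BennettDivincenzoSmolin1997, p. 3218 (Q ≤ 1 − 2ε); DelfosseZemor2013, §3.3–3.4 (2|ℰ| ≤ rank H, R ≤ 1 − 2p, Thm. 3.5)] -/
theorem CSSCode.k_le_card_mul_erasure (C : CSSCode RX RZ V) {a b : ℝ} (ha : 0 ≤ a) (hb : 0 ≤ b)
    (hab : a + b ≤ 1) :
    (C.k : ℝ) ≤ Fintype.card V * (1 - a - b +
      ErasureDecoder.uncorrectableProb {x | C.HX *ᵥ x = 0} (C.rowSpZ : Set (V → ZMod 2)) a +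
      ErasureDecoder.uncorrectableProb {x | C.HZ *ᵥ x = 0} (C.rowSpX : Set (V → ZMod 2)) b) := by
  classical
  have hw : ∀ E F : Finset V, 0 ≤ a ^ E.card * (b ^ F.card * (1 - a - b) ^ (Eᶜ.card - F.card)) :=
    fun E F => mul_nonneg (pow_nonneg ha _) (mul_nonneg (pow_nonneg hb _) (pow_nonneg (by linarith) _))
  have hsum := Finset.sum_le_sum fun E (_ : E ∈ (univ : Finset (Finset V))) =>
    Finset.sum_le_sum fun F (hF : F ∈ (Eᶜ).powerset) =>
      pointwise_rate_bound C E F (Finset.mem_powerset.1 hF) (hw E F)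
  simp only [Finset.sum_add_distrib, ← Finset.mul_sum] at hsum
  rw [sum_pairWeight_mul_left a b (fun E => (E.card : ℝ)),
    sum_pairWeight_mul_right a b (fun F => (F.card : ℝ)),
    sum_pairWeight_mul_left a b (fun _ => (Fintype.card V : ℝ) - C.k),
    sum_pairWeight_mul_left a b
      (fun E => if IsCorrectableErasure {x | C.HX *ᵥ x = 0} (C.rowSpZ : Set (V → ZMod 2)) E then (0 : ℝ) else 1),
    sum_pairWeight_mul_right a b
      (fun F => if IsCorrectableErasure {x | C.HZ *ᵥ x = 0} (C.rowSpX : Set (V → ZMod 2)) F then (0 : ℝ) else 1),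
    sum_bernoulliWeight_mul_card, sum_bernoulliWeight_mul_card,
    sum_bernoulliWeight_mul_ite_eq_uncorrectableProb, sum_bernoulliWeight_mul_ite_eq_uncorrectableProb,
    ← Finset.sum_mul, sum_bernoulliWeight, one_mul] at hsum
  linarith

open Classical in
/-- **FINITE-SIZE RATE BOUND, code capacity, ANY decoders.** For every CSS code on `n` qubits, every decoder
`D_Z` of the `X`-syndrome (phase flips), every decoder `D_X` of the `Z`-syndrome (bit flips) and flip rates
`p, p' ≥ 0` with `p + p' ≤ 1/2`: `k ≤ n · (1 − 2p − 2p' + 2 P^Z_p[D_Z fails] + 2 P^X_{p'}[D_X fails])` — flips at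
rate `p` are erasures at rate `2p` filled with fair coins. [cite: BennettDivincenzoSmolin1997, p. 3218 (Q ≤ 1 − 2ε); RichardsonUrbanke2008, Lemma 4.78 (Erasure Decomposition Lemma)] -/
theorem CSSCode.k_le_card_mul_capacity (C : CSSCode RX RZ V) (DZ : Decoder (RX → ZMod 2) (V → ZMod 2))
    (DX : Decoder (RZ → ZMod 2) (V → ZMod 2)) {p p' : ℝ} (hp : 0 ≤ p) (hp' : 0 ≤ p') (hpp : p + p' ≤ 1 / 2) :
    (C.k : ℝ) ≤ Fintype.card V * (1 - 2 * p - 2 * p' +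
      2 * ∑ e ∈ univ.filter (fun e : V → ZMod 2 =>
          ¬ DZ.Corrects C.zSyndrome (C.rowSpZ : Set (V → ZMod 2)) e), bernoulliWeight p (supp e) +
      2 * ∑ e ∈ univ.filter (fun e : V → ZMod 2 =>
          ¬ DX.Corrects C.xSyndrome (C.rowSpX : Set (V → ZMod 2)) e), bernoulliWeight p' (supp e)) := by
  have h := C.k_le_card_mul_erasure (a := 2 * p) (b := 2 * p') (by linarith) (by linarith) (by linarith)
  have hZ := C.zUncorrectableProb_two_mul_le DZ hp (by linarith)
  have hX := C.xUncorrectableProb_two_mul_le DX hp' (by linarith)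
  have hn : (0 : ℝ) ≤ Fintype.card V := Nat.cast_nonneg _
  nlinarith [mul_le_mul_of_nonneg_left hZ hn, mul_le_mul_of_nonneg_left hX hn]

end Finite

/-! ### Families: rate versus certified thresholds -/

section Thresholds

/-- A rate strictly inside two overlapping constraints: if `a, b > 0`, `0 ≤ c < a + b`, some `0 ≤ y ≤ c` has
`y < a` and `c - y < b`. [folklore] -/
private theorem exists_rate_between' {a b c : ℝ} (hc : 0 ≤ c) (ha : 0 < a) (hb : 0 < b) (h : c < a + b) :
    ∃ y : ℝ, 0 ≤ y ∧ y ≤ c ∧ y < a ∧ c - y < b := by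
  refine ⟨min c (max 0 ((c - b + a) / 2)), le_min hc (le_max_left _ _), min_le_left _ _, ?_, ?_⟩
  · exact lt_of_le_of_lt (min_le_right _ _) (max_lt ha (by linarith))
  · have : c - b < min c (max 0 ((c - b + a) / 2)) :=
      lt_min (by linarith) (lt_of_lt_of_le (by linarith) (le_max_right _ _))
    linarith

variable {RX RZ Q : ℕ → Type*} [∀ i, Fintype (Q i)] [∀ i, DecidableEq (Q i)] [∀ i, Fintype (RX i)]
  [∀ i, Fintype (RZ i)]

omit [∀ i, DecidableEq (Q i)] [∀ i, Fintype (RZ i)] in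
/-- A family with `k ≥ 1` and `R n ≤ k` has `R ≤ 1`. [cite: BravyiEtAl2024, §4, proof of Lemma 1 (k = n − rk H^X − rk H^Z)] -/
private theorem rate_le_one (C : ∀ i, CSSCode (RX i) (RZ i) (Q i)) (hk : ∀ i, 0 < (C i).k) {R : ℝ}
    (hR : ∀ i, R * Fintype.card (Q i) ≤ (C i).k) : R ≤ 1 := by
  have hn : (0 : ℝ) < Fintype.card (Q 0) := by
    exact_mod_cast lt_of_lt_of_le (hk 0) (C 0).k_le_card
  have h1 : ((C 0).k : ℝ) ≤ Fintype.card (Q 0) := by exact_mod_cast (C 0).k_le_card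
  have h2 : R * Fintype.card (Q 0) ≤ 1 * Fintype.card (Q 0) := by linarith [hR 0]
  exact le_of_mul_le_mul_right h2 hn

/-- **Two correctable erasure rates cost `y_Z + y_X` of rate.** For a family of CSS codes with `k ≥ 1` and rate
`≥ R` (`R n_i ≤ k_i`): if the `Z`-sector erasures of rate `a` AND the `X`-sector erasures of rate `b` are both
eventually correctable with probability `→ 1` (`a, b ≥ 0`, `a + b ≤ 1`), then `a + b ≤ 1 − R`.
[cite: BennettDivincenzoSmolin1997, p. 3218 (Q = max{0, 1 − 2ε}); DelfosseZemor2013, §3 eq. (capacity) and Thm. 3.5 (R ≤ 1 − 2p)] -/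
theorem erasure_rates_add_le_one_sub_rate (C : ∀ i, CSSCode (RX i) (RZ i) (Q i)) (hk : ∀ i, 0 < (C i).k)
    {R : ℝ} (hR : ∀ i, R * Fintype.card (Q i) ≤ (C i).k) {a b : ℝ} (ha : 0 ≤ a) (hb : 0 ≤ b) (hab : a + b ≤ 1)
    (hZ : BelowThreshold
      (fun i y => ErasureDecoder.uncorrectableProb {x : Q i → ZMod 2 | (C i).HX *ᵥ x = 0}
        ((C i).rowSpZ : Set (Q i → ZMod 2)) y) a)
    (hX : BelowThreshold
      (fun i y => ErasureDecoder.uncorrectableProb {x : Q i → ZMod 2 | (C i).HZ *ᵥ x = 0}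
        ((C i).rowSpX : Set (Q i → ZMod 2)) y) b) :
    a + b ≤ 1 - R := by
  have hbound : ∀ i, R ≤ 1 - a - b +
      (ErasureDecoder.uncorrectableProb {x : Q i → ZMod 2 | (C i).HX *ᵥ x = 0}
          ((C i).rowSpZ : Set (Q i → ZMod 2)) a +
        ErasureDecoder.uncorrectableProb {x : Q i → ZMod 2 | (C i).HZ *ᵥ x = 0}
          ((C i).rowSpX : Set (Q i → ZMod 2)) b) := by
    intro i
    have hn : (0 : ℝ) < Fintype.card (Q i) := by
      exact_mod_cast lt_of_lt_of_le (hk i) (C i).k_le_card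
    have h := ((hR i).trans ((C i).k_le_card_mul_erasure ha hb hab))
    rw [mul_comm] at h
    have h' := le_of_mul_le_mul_left h hn
    linarith
  have hlim : Tendsto (fun i => 1 - a - b +
      (ErasureDecoder.uncorrectableProb {x : Q i → ZMod 2 | (C i).HX *ᵥ x = 0}
          ((C i).rowSpZ : Set (Q i → ZMod 2)) a +
        ErasureDecoder.uncorrectableProb {x : Q i → ZMod 2 | (C i).HZ *ᵥ x = 0}
          ((C i).rowSpX : Set (Q i → ZMod 2)) b)) atTop (𝓝 (1 - a - b + (0 + 0))) :=
    tendsto_const_nhds.add (hZ.add hX)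
  have := le_of_tendsto_of_tendsto' tendsto_const_nhds hlim hbound
  linarith

/-- **THE RATE–ERASURE-THRESHOLD TRADEOFF.** For a family of CSS codes with `k ≥ 1` and rate `≥ R`: if `a` is a
certified erasure threshold lower bound for the `Z`-sector and `b` one for the `X`-sector, then `a + b ≤ 1 − R`
(the rate-free bound `a + b ≤ 1` is `erasure_thresholds_add_le_one`). [cite: BennettDivincenzoSmolin1997, p. 3218 (Q = max{0, 1 − 2ε}); DelfosseZemor2013, §3 eq. (capacity) and Thm. 3.5 (R ≤ 1 − 2p)] -/
theorem erasure_thresholds_add_le_one_sub_rate (C : ∀ i, CSSCode (RX i) (RZ i) (Q i)) (hk : ∀ i, 0 < (C i).k)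
    {R : ℝ} (hR : ∀ i, R * Fintype.card (Q i) ≤ (C i).k) {a b : ℝ}
    (ha : IsThresholdLowerBound
      (fun i y => ErasureDecoder.uncorrectableProb {x : Q i → ZMod 2 | (C i).HX *ᵥ x = 0}
        ((C i).rowSpZ : Set (Q i → ZMod 2)) y) a)
    (hb : IsThresholdLowerBound
      (fun i y => ErasureDecoder.uncorrectableProb {x : Q i → ZMod 2 | (C i).HZ *ᵥ x = 0}
        ((C i).rowSpX : Set (Q i → ZMod 2)) y) b) :
    a + b ≤ 1 - R := by
  by_contra h
  push Not at h
  have hab1 : a + b ≤ 1 := erasure_thresholds_add_le_one C hk ha hb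
  have hR1 : R ≤ 1 := rate_le_one C hk hR
  -- a total erasure rate strictly between `1 - R` and `a + b`
  set c := (1 - R + (a + b)) / 2 with hc
  have hc0 : 0 ≤ c := by rw [hc]; linarith
  have hRc : 1 - R < c := by rw [hc]; linarith
  have hcab : c < a + b := by rw [hc]; linarith
  have hZ0 : BelowThreshold
      (fun i y => ErasureDecoder.uncorrectableProb {x : Q i → ZMod 2 | (C i).HX *ᵥ x = 0}
        ((C i).rowSpZ : Set (Q i → ZMod 2)) y) 0 := by
    change Tendsto (fun i => ErasureDecoder.uncorrectableProb {x : Q i → ZMod 2 | (C i).HX *ᵥ x = 0}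
        ((C i).rowSpZ : Set (Q i → ZMod 2)) 0) atTop (𝓝 0)
    simpa only [uncorrectableProb_zero] using tendsto_const_nhds
  have hX0 : BelowThreshold
      (fun i y => ErasureDecoder.uncorrectableProb {x : Q i → ZMod 2 | (C i).HZ *ᵥ x = 0}
        ((C i).rowSpX : Set (Q i → ZMod 2)) y) 0 := by
    change Tendsto (fun i => ErasureDecoder.uncorrectableProb {x : Q i → ZMod 2 | (C i).HZ *ᵥ x = 0}
        ((C i).rowSpX : Set (Q i → ZMod 2)) 0) atTop (𝓝 0)
    simpa only [uncorrectableProb_zero] using tendsto_const_nhds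
  rcases le_or_gt a 0 with ha0 | ha0
  · have h2 := erasure_rates_add_le_one_sub_rate C hk hR le_rfl hc0 (by linarith) hZ0 (hb c hc0 (by linarith))
    linarith
  rcases le_or_gt b 0 with hb0 | hb0
  · have h2 := erasure_rates_add_le_one_sub_rate C hk hR hc0 le_rfl (by linarith) (ha c hc0 (by linarith)) hX0
    linarith
  obtain ⟨y, hy0, hyc, hya, hyb⟩ := exists_rate_between' hc0 ha0 hb0 hcab
  have h2 := erasure_rates_add_le_one_sub_rate C hk hR hy0 (by linarith : (0 : ℝ) ≤ c - y) (by linarith)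
    (ha y hy0 hya) (hb (c - y) (by linarith) hyb)
  linarith

/-- **Accuracy-threshold form**: `y_c^Z + y_c^X ≤ 1 − R` for the two sectors' erasure accuracy thresholds of any
family of CSS codes with `k ≥ 1` and rate `≥ R`. [cite: BennettDivincenzoSmolin1997, p. 3218 (Q = max{0, 1 − 2ε}); DennisEtAl2002, §4.6 (p_c)] -/
theorem erasure_accuracyThresholds_add_le_one_sub_rate (C : ∀ i, CSSCode (RX i) (RZ i) (Q i))
    (hk : ∀ i, 0 < (C i).k) {R : ℝ} (hR : ∀ i, R * Fintype.card (Q i) ≤ (C i).k) :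
    accuracyThreshold (fun i y => ErasureDecoder.uncorrectableProb {x : Q i → ZMod 2 | (C i).HX *ᵥ x = 0}
        ((C i).rowSpZ : Set (Q i → ZMod 2)) y) +
      accuracyThreshold (fun i y => ErasureDecoder.uncorrectableProb {x : Q i → ZMod 2 | (C i).HZ *ᵥ x = 0}
        ((C i).rowSpX : Set (Q i → ZMod 2)) y) ≤ 1 - R :=
  erasure_thresholds_add_le_one_sub_rate C hk hR (isThresholdLowerBound_accuracyThreshold _)
    (isThresholdLowerBound_accuracyThreshold _)

/-- **One sector alone**: every certified `Z`-sector erasure threshold lower bound of a family of CSS codes with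
`k ≥ 1` and rate `≥ R` is `≤ 1 − R` (one bit of redundancy per erased qubit for this sector).
[cite: BennettDivincenzoSmolin1997, p. 3218; DelfosseZemor2013, §3.3 (2|ℰ| ≤ rank H)] -/
theorem erasure_threshold_le_one_sub_rate (C : ∀ i, CSSCode (RX i) (RZ i) (Q i)) (hk : ∀ i, 0 < (C i).k)
    {R : ℝ} (hR : ∀ i, R * Fintype.card (Q i) ≤ (C i).k) {a : ℝ}
    (ha : IsThresholdLowerBound
      (fun i y => ErasureDecoder.uncorrectableProb {x : Q i → ZMod 2 | (C i).HX *ᵥ x = 0}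
        ((C i).rowSpZ : Set (Q i → ZMod 2)) y) a) :
    a ≤ 1 - R := by
  have h := erasure_thresholds_add_le_one_sub_rate C hk hR ha
    (isThresholdLowerBound_of_nonpos (P := fun i y =>
      ErasureDecoder.uncorrectableProb {x : Q i → ZMod 2 | (C i).HZ *ᵥ x = 0}
        ((C i).rowSpX : Set (Q i → ZMod 2)) y) le_rfl)
  linarith

/-- The `X`-sector alone: every certified `X`-sector erasure threshold lower bound is `≤ 1 − R`.
[cite: BennettDivincenzoSmolin1997, p. 3218; DelfosseZemor2013, §3.3 (2|ℰ| ≤ rank H)] -/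
theorem x_erasure_threshold_le_one_sub_rate (C : ∀ i, CSSCode (RX i) (RZ i) (Q i)) (hk : ∀ i, 0 < (C i).k)
    {R : ℝ} (hR : ∀ i, R * Fintype.card (Q i) ≤ (C i).k) {b : ℝ}
    (hb : IsThresholdLowerBound
      (fun i y => ErasureDecoder.uncorrectableProb {x : Q i → ZMod 2 | (C i).HZ *ᵥ x = 0}
        ((C i).rowSpX : Set (Q i → ZMod 2)) y) b) :
    b ≤ 1 - R := by
  have h := erasure_thresholds_add_le_one_sub_rate C hk hR
    (isThresholdLowerBound_of_nonpos (P := fun i y =>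
      ErasureDecoder.uncorrectableProb {x : Q i → ZMod 2 | (C i).HX *ᵥ x = 0}
        ((C i).rowSpZ : Set (Q i → ZMod 2)) y) le_rfl) hb
  linarith

/-- **Symmetric families** (the two sectors have the same erasure behaviour, e.g. `X ↔ Z` self-dual families):
every certified erasure threshold lower bound is `≤ (1 − R)/2` — the Bennett–DiVincenzo–Smolin capacity value
`ε ≤ (1 − Q)/2`. [cite: BennettDivincenzoSmolin1997, p. 3218 (Q = max{0, 1 − 2ε})] -/
theorem erasure_threshold_le_half_sub_rate_of_symm (C : ∀ i, CSSCode (RX i) (RZ i) (Q i))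
    (hk : ∀ i, 0 < (C i).k) {R : ℝ} (hR : ∀ i, R * Fintype.card (Q i) ≤ (C i).k)
    (hsymm : ∀ i y, ErasureDecoder.uncorrectableProb {x : Q i → ZMod 2 | (C i).HZ *ᵥ x = 0}
        ((C i).rowSpX : Set (Q i → ZMod 2)) y =
      ErasureDecoder.uncorrectableProb {x : Q i → ZMod 2 | (C i).HX *ᵥ x = 0}
        ((C i).rowSpZ : Set (Q i → ZMod 2)) y)
    {a : ℝ}
    (ha : IsThresholdLowerBound
      (fun i y => ErasureDecoder.uncorrectableProb {x : Q i → ZMod 2 | (C i).HX *ᵥ x = 0}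
        ((C i).rowSpZ : Set (Q i → ZMod 2)) y) a) :
    a ≤ (1 - R) / 2 := by
  have heq : (fun i y => ErasureDecoder.uncorrectableProb {x : Q i → ZMod 2 | (C i).HZ *ᵥ x = 0}
        ((C i).rowSpX : Set (Q i → ZMod 2)) y) =
      (fun i y => ErasureDecoder.uncorrectableProb {x : Q i → ZMod 2 | (C i).HX *ᵥ x = 0}
        ((C i).rowSpZ : Set (Q i → ZMod 2)) y) := by
    funext i y
    exact hsymm i y
  have hb : IsThresholdLowerBound
      (fun i y => ErasureDecoder.uncorrectableProb {x : Q i → ZMod 2 | (C i).HZ *ᵥ x = 0}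
        ((C i).rowSpX : Set (Q i → ZMod 2)) y) a := by
    rw [heq]
    exact ha
  have := erasure_thresholds_add_le_one_sub_rate C hk hR ha hb
  linarith

open Classical in
/-- **Two below-threshold flip rates cost `2p + 2p'` of rate.** For a family of CSS codes with `k ≥ 1` and rate
`≥ R` and ANY decoder families: if phase flips of rate `p` and bit flips of rate `p'` are both eventually corrected
with probability `→ 1` (`p, p' ≥ 0`, `p + p' ≤ 1/2`), then `p + p' ≤ (1 − R)/2`.
[cite: BennettDivincenzoSmolin1997, p. 3218 (Q ≤ 1 − 2ε); RichardsonUrbanke2008, Lemma 4.78 (Erasure Decomposition Lemma)] -/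
theorem capacity_rates_add_le_half_sub_rate (C : ∀ i, CSSCode (RX i) (RZ i) (Q i)) (hk : ∀ i, 0 < (C i).k)
    {R : ℝ} (hR : ∀ i, R * Fintype.card (Q i) ≤ (C i).k)
    (DZ : ∀ i, Decoder (RX i → ZMod 2) (Q i → ZMod 2)) (DX : ∀ i, Decoder (RZ i → ZMod 2) (Q i → ZMod 2))
    {p p' : ℝ} (hp : 0 ≤ p) (hp' : 0 ≤ p') (hpp : p + p' ≤ 1 / 2)
    (hZ : BelowThreshold (fun i p => ∑ e ∈ univ.filter (fun e : Q i → ZMod 2 =>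
        ¬ (DZ i).Corrects (C i).zSyndrome ((C i).rowSpZ : Set (Q i → ZMod 2)) e), bernoulliWeight p (supp e)) p)
    (hX : BelowThreshold (fun i p => ∑ e ∈ univ.filter (fun e : Q i → ZMod 2 =>
        ¬ (DX i).Corrects (C i).xSyndrome ((C i).rowSpX : Set (Q i → ZMod 2)) e), bernoulliWeight p (supp e)) p') :
    p + p' ≤ (1 - R) / 2 := by
  have hbound : ∀ i, R ≤ 1 - 2 * p - 2 * p' +
      (2 * (∑ e ∈ univ.filter (fun e : Q i → ZMod 2 =>
          ¬ (DZ i).Corrects (C i).zSyndrome ((C i).rowSpZ : Set (Q i → ZMod 2)) e), bernoulliWeight p (supp e)) +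
        2 * ∑ e ∈ univ.filter (fun e : Q i → ZMod 2 =>
          ¬ (DX i).Corrects (C i).xSyndrome ((C i).rowSpX : Set (Q i → ZMod 2)) e),
          bernoulliWeight p' (supp e)) := by
    intro i
    have hn : (0 : ℝ) < Fintype.card (Q i) := by
      exact_mod_cast lt_of_lt_of_le (hk i) (C i).k_le_card
    have h := (hR i).trans ((C i).k_le_card_mul_capacity (DZ i) (DX i) hp hp' hpp)
    rw [mul_comm] at h
    have h' := le_of_mul_le_mul_left h hn
    linarith
  have hlim : Tendsto (fun i => 1 - 2 * p - 2 * p' +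
      (2 * (∑ e ∈ univ.filter (fun e : Q i → ZMod 2 =>
          ¬ (DZ i).Corrects (C i).zSyndrome ((C i).rowSpZ : Set (Q i → ZMod 2)) e), bernoulliWeight p (supp e)) +
        2 * ∑ e ∈ univ.filter (fun e : Q i → ZMod 2 =>
          ¬ (DX i).Corrects (C i).xSyndrome ((C i).rowSpX : Set (Q i → ZMod 2)) e),
          bernoulliWeight p' (supp e))) atTop (𝓝 (1 - 2 * p - 2 * p' + (2 * 0 + 2 * 0))) :=
    tendsto_const_nhds.add ((hZ.const_mul 2).add (hX.const_mul 2))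
  have := le_of_tendsto_of_tendsto' tendsto_const_nhds hlim hbound
  linarith

open Classical in
/-- **One sector alone, any decoder family**: if phase flips of rate `0 ≤ p ≤ 1/2` are eventually corrected with
probability `→ 1` in a family of CSS codes with `k ≥ 1` and rate `≥ R`, then `p ≤ (1 − R)/2` (take the `X`-sector
erasure rate `0` in the finite bound). [cite: BennettDivincenzoSmolin1997, p. 3218 (Q ≤ 1 − 2ε); RichardsonUrbanke2008, Lemma 4.78] -/
theorem capacity_rate_le_half_sub_rate (C : ∀ i, CSSCode (RX i) (RZ i) (Q i)) (hk : ∀ i, 0 < (C i).k)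
    {R : ℝ} (hR : ∀ i, R * Fintype.card (Q i) ≤ (C i).k)
    (DZ : ∀ i, Decoder (RX i → ZMod 2) (Q i → ZMod 2)) {p : ℝ} (hp : 0 ≤ p) (hp1 : p ≤ 1 / 2)
    (hZ : BelowThreshold (fun i p => ∑ e ∈ univ.filter (fun e : Q i → ZMod 2 =>
        ¬ (DZ i).Corrects (C i).zSyndrome ((C i).rowSpZ : Set (Q i → ZMod 2)) e), bernoulliWeight p (supp e)) p) :
    p ≤ (1 - R) / 2 := by
  have hbound : ∀ i, R ≤ 1 - 2 * p +
      2 * ∑ e ∈ univ.filter (fun e : Q i → ZMod 2 =>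
          ¬ (DZ i).Corrects (C i).zSyndrome ((C i).rowSpZ : Set (Q i → ZMod 2)) e), bernoulliWeight p (supp e) := by
    intro i
    have hn : (0 : ℝ) < Fintype.card (Q i) := by
      exact_mod_cast lt_of_lt_of_le (hk i) (C i).k_le_card
    have h1 := (C i).k_le_card_mul_erasure (a := 2 * p) (b := 0) (by linarith) le_rfl (by linarith)
    rw [uncorrectableProb_zero] at h1
    have h2 := (C i).zUncorrectableProb_two_mul_le (DZ i) hp hp1
    have h3 : ((C i).k : ℝ) ≤ Fintype.card (Q i) * (1 - 2 * p +
        2 * ∑ e ∈ univ.filter (fun e : Q i → ZMod 2 =>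
          ¬ (DZ i).Corrects (C i).zSyndrome ((C i).rowSpZ : Set (Q i → ZMod 2)) e), bernoulliWeight p (supp e)) := by
      nlinarith [mul_le_mul_of_nonneg_left h2 hn.le]
    have h := (hR i).trans h3
    rw [mul_comm] at h
    have h' := le_of_mul_le_mul_left h hn
    linarith
  have hlim : Tendsto (fun i => 1 - 2 * p +
      2 * ∑ e ∈ univ.filter (fun e : Q i → ZMod 2 =>
          ¬ (DZ i).Corrects (C i).zSyndrome ((C i).rowSpZ : Set (Q i → ZMod 2)) e), bernoulliWeight p (supp e))
      atTop (𝓝 (1 - 2 * p + 2 * 0)) :=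
    tendsto_const_nhds.add (hZ.const_mul 2)
  have := le_of_tendsto_of_tendsto' tendsto_const_nhds hlim hbound
  linarith

open Classical in
/-- The `X`-sector alone, any decoder family: bit flips of rate `0 ≤ p' ≤ 1/2` below threshold force
`p' ≤ (1 − R)/2` (the `X ↔ Z` exchange of `capacity_rate_le_half_sub_rate`).
[cite: BennettDivincenzoSmolin1997, p. 3218 (Q ≤ 1 − 2ε); RichardsonUrbanke2008, Lemma 4.78] -/
theorem x_capacity_rate_le_half_sub_rate (C : ∀ i, CSSCode (RX i) (RZ i) (Q i)) (hk : ∀ i, 0 < (C i).k)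
    {R : ℝ} (hR : ∀ i, R * Fintype.card (Q i) ≤ (C i).k)
    (DX : ∀ i, Decoder (RZ i → ZMod 2) (Q i → ZMod 2)) {p' : ℝ} (hp' : 0 ≤ p') (hp1 : p' ≤ 1 / 2)
    (hX : BelowThreshold (fun i p => ∑ e ∈ univ.filter (fun e : Q i → ZMod 2 =>
        ¬ (DX i).Corrects (C i).xSyndrome ((C i).rowSpX : Set (Q i → ZMod 2)) e), bernoulliWeight p (supp e)) p') :
    p' ≤ (1 - R) / 2 :=
  capacity_rate_le_half_sub_rate (fun i => (C i).swap) (fun i => by rw [CSSCode.k_swap]; exact hk i)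
    (fun i => by rw [CSSCode.k_swap]; exact hR i) DX hp' hp1 hX

open Classical in
/-- **THE RATE–CODE-CAPACITY-THRESHOLD TRADEOFF, any decoders.** For a family of CSS codes with `k ≥ 1` and rate
`≥ R` and ANY decoder families `D_Z` (phase flips) and `D_X` (bit flips): if `a` is a certified code-capacity
threshold lower bound for the `Z`-sector and `b` one for the `X`-sector, then `a + b ≤ (1 − R)/2`
(the rate-free bound `a + b ≤ 1/2` is `capacity_thresholds_add_le_half`).
[cite: BennettDivincenzoSmolin1997, p. 3218 (Q ≤ 1 − 2ε); RichardsonUrbanke2008, Lemma 4.78 (Erasure Decomposition Lemma)] -/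
theorem capacity_thresholds_add_le_half_sub_rate (C : ∀ i, CSSCode (RX i) (RZ i) (Q i)) (hk : ∀ i, 0 < (C i).k)
    {R : ℝ} (hR : ∀ i, R * Fintype.card (Q i) ≤ (C i).k)
    (DZ : ∀ i, Decoder (RX i → ZMod 2) (Q i → ZMod 2)) (DX : ∀ i, Decoder (RZ i → ZMod 2) (Q i → ZMod 2))
    {a b : ℝ}
    (ha : IsThresholdLowerBound (fun i p => ∑ e ∈ univ.filter (fun e : Q i → ZMod 2 =>
        ¬ (DZ i).Corrects (C i).zSyndrome ((C i).rowSpZ : Set (Q i → ZMod 2)) e), bernoulliWeight p (supp e)) a)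
    (hb : IsThresholdLowerBound (fun i p => ∑ e ∈ univ.filter (fun e : Q i → ZMod 2 =>
        ¬ (DX i).Corrects (C i).xSyndrome ((C i).rowSpX : Set (Q i → ZMod 2)) e), bernoulliWeight p (supp e)) b) :
    a + b ≤ (1 - R) / 2 := by
  by_contra h
  push Not at h
  have hab1 : a + b ≤ 1 / 2 := capacity_thresholds_add_le_half C hk DZ DX ha hb
  have hR1 : R ≤ 1 := rate_le_one C hk hR
  set c := ((1 - R) / 2 + (a + b)) / 2 with hc
  have hc0 : 0 ≤ c := by rw [hc]; linarith
  have hRc : (1 - R) / 2 < c := by rw [hc]; linarith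
  have hcab : c < a + b := by rw [hc]; linarith
  have hc1 : c ≤ 1 / 2 := by linarith
  rcases le_or_gt a 0 with ha0 | ha0
  · have h2 := x_capacity_rate_le_half_sub_rate C hk hR DX hc0 hc1 (hb c hc0 (by linarith))
    linarith
  rcases le_or_gt b 0 with hb0 | hb0
  · have h2 := capacity_rate_le_half_sub_rate C hk hR DZ hc0 hc1 (ha c hc0 (by linarith))
    linarith
  obtain ⟨y, hy0, hyc, hya, hyb⟩ := exists_rate_between' hc0 ha0 hb0 hcab
  have h2 := capacity_rates_add_le_half_sub_rate C hk hR DZ DX hy0 (by linarith : (0 : ℝ) ≤ c - y)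
    (by linarith) (ha y hy0 hya) (hb (c - y) (by linarith) hyb)
  linarith

open Classical in
/-- **Accuracy-threshold form, any decoders**: `p_c^Z + p_c^X ≤ (1 − R)/2` for the code-capacity accuracy
thresholds of the two sectors of any family of CSS codes with `k ≥ 1` and rate `≥ R`.
[cite: BennettDivincenzoSmolin1997, p. 3218 (Q ≤ 1 − 2ε); DennisEtAl2002, §4.6 (p_c)] -/
theorem capacity_accuracyThresholds_add_le_half_sub_rate (C : ∀ i, CSSCode (RX i) (RZ i) (Q i))
    (hk : ∀ i, 0 < (C i).k) {R : ℝ} (hR : ∀ i, R * Fintype.card (Q i) ≤ (C i).k)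
    (DZ : ∀ i, Decoder (RX i → ZMod 2) (Q i → ZMod 2)) (DX : ∀ i, Decoder (RZ i → ZMod 2) (Q i → ZMod 2)) :
    accuracyThreshold (fun i p => ∑ e ∈ univ.filter (fun e : Q i → ZMod 2 =>
        ¬ (DZ i).Corrects (C i).zSyndrome ((C i).rowSpZ : Set (Q i → ZMod 2)) e), bernoulliWeight p (supp e)) +
      accuracyThreshold (fun i p => ∑ e ∈ univ.filter (fun e : Q i → ZMod 2 =>
        ¬ (DX i).Corrects (C i).xSyndrome ((C i).rowSpX : Set (Q i → ZMod 2)) e), bernoulliWeight p (supp e))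
      ≤ (1 - R) / 2 :=
  capacity_thresholds_add_le_half_sub_rate C hk hR DZ DX (isThresholdLowerBound_accuracyThreshold _)
    (isThresholdLowerBound_accuracyThreshold _)

open Classical in
/-- **One sector's accuracy threshold alone**: `p_c^Z ≤ (1 − R)/2` for every decoder family.
[cite: BennettDivincenzoSmolin1997, p. 3218 (Q ≤ 1 − 2ε); DennisEtAl2002, §4.6 (p_c)] -/
theorem capacity_accuracyThreshold_le_half_sub_rate (C : ∀ i, CSSCode (RX i) (RZ i) (Q i))
    (hk : ∀ i, 0 < (C i).k) {R : ℝ} (hR : ∀ i, R * Fintype.card (Q i) ≤ (C i).k)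
    (DZ : ∀ i, Decoder (RX i → ZMod 2) (Q i → ZMod 2)) :
    accuracyThreshold (fun i p => ∑ e ∈ univ.filter (fun e : Q i → ZMod 2 =>
        ¬ (DZ i).Corrects (C i).zSyndrome ((C i).rowSpZ : Set (Q i → ZMod 2)) e), bernoulliWeight p (supp e))
      ≤ (1 - R) / 2 := by
  have hT := isThresholdLowerBound_accuracyThreshold (fun i p => ∑ e ∈ univ.filter (fun e : Q i → ZMod 2 =>
        ¬ (DZ i).Corrects (C i).zSyndrome ((C i).rowSpZ : Set (Q i → ZMod 2)) e), bernoulliWeight p (supp e))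
  have h1 := capacity_threshold_le_half C hk DZ hT
  by_contra h
  push Not at h
  -- a rate strictly between `(1 - R)/2` and the accuracy threshold
  set c := ((1 - R) / 2 + accuracyThreshold (fun i p => ∑ e ∈ univ.filter (fun e : Q i → ZMod 2 =>
        ¬ (DZ i).Corrects (C i).zSyndrome ((C i).rowSpZ : Set (Q i → ZMod 2)) e), bernoulliWeight p (supp e))) / 2
    with hc
  have hR1 : R ≤ 1 := rate_le_one C hk hR
  have hc0 : 0 ≤ c := by rw [hc]; linarith
  have hc1 : c ≤ 1 / 2 := by rw [hc]; linarith
  have h2 := capacity_rate_le_half_sub_rate C hk hR DZ hc0 hc1 (hT c hc0 (by rw [hc]; linarith))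
  rw [hc] at h2
  linarith

open Classical in
/-- **Symmetric families, symmetric decoding**: if the two sectors have the same failure probabilities, every
certified code-capacity threshold lower bound is `≤ (1 − R)/4`. [cite: BennettDivincenzoSmolin1997, p. 3218 (Q ≤ 1 − 2ε); RichardsonUrbanke2008, Lemma 4.78] -/
theorem capacity_threshold_le_quarter_sub_rate_of_symm (C : ∀ i, CSSCode (RX i) (RZ i) (Q i))
    (hk : ∀ i, 0 < (C i).k) {R : ℝ} (hR : ∀ i, R * Fintype.card (Q i) ≤ (C i).k)
    (DZ : ∀ i, Decoder (RX i → ZMod 2) (Q i → ZMod 2)) (DX : ∀ i, Decoder (RZ i → ZMod 2) (Q i → ZMod 2))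
    (hsymm : ∀ i p, (∑ e ∈ univ.filter (fun e : Q i → ZMod 2 =>
        ¬ (DX i).Corrects (C i).xSyndrome ((C i).rowSpX : Set (Q i → ZMod 2)) e), bernoulliWeight p (supp e)) =
      ∑ e ∈ univ.filter (fun e : Q i → ZMod 2 =>
        ¬ (DZ i).Corrects (C i).zSyndrome ((C i).rowSpZ : Set (Q i → ZMod 2)) e), bernoulliWeight p (supp e))
    {a : ℝ}
    (ha : IsThresholdLowerBound (fun i p => ∑ e ∈ univ.filter (fun e : Q i → ZMod 2 =>
        ¬ (DZ i).Corrects (C i).zSyndrome ((C i).rowSpZ : Set (Q i → ZMod 2)) e), bernoulliWeight p (supp e)) a) :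
    a ≤ (1 - R) / 4 := by
  have heq : (fun i p => ∑ e ∈ univ.filter (fun e : Q i → ZMod 2 =>
        ¬ (DX i).Corrects (C i).xSyndrome ((C i).rowSpX : Set (Q i → ZMod 2)) e), bernoulliWeight p (supp e)) =
      (fun i p => ∑ e ∈ univ.filter (fun e : Q i → ZMod 2 =>
        ¬ (DZ i).Corrects (C i).zSyndrome ((C i).rowSpZ : Set (Q i → ZMod 2)) e), bernoulliWeight p (supp e)) := by
    funext i p
    exact hsymm i p
  have hb : IsThresholdLowerBound (fun i p => ∑ e ∈ univ.filter (fun e : Q i → ZMod 2 =>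
        ¬ (DX i).Corrects (C i).xSyndrome ((C i).rowSpX : Set (Q i → ZMod 2)) e), bernoulliWeight p (supp e)) a := by
    rw [heq]
    exact ha
  have := capacity_thresholds_add_le_half_sub_rate C hk hR DZ DX ha hb
  linarith

end Thresholds

end Literature.InformationTheory.QuantumCodes
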